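import Summits.AnomalousDissipation.AnomalousDissipation.Theorems.SolenoidalFractalHomogenisationLagrangianStepWCrossing

/-!
# K1L_D (stmt-AnomalousDissipation-27980): algebra of the residue currency `RelSmall` — sum, difference, monotonicity, sum of a list of pieces
(helper, `--supports 27980 --as helper`; prover ad-k1loc-p3 g7 on tenure offer «#8»; cited by planner ad-ideate-p5's CERT-(i) and p1 g12's A5)

`RelSmall R A ρ` (`…WCrossing` §1) says `bsymb R(k;p,q)² ≤ ρ²·symb A(k,p)·symb A(k,q)` for transverse `p, q`.  For a transversely nonnegative
comparison tensor `A` and nonnegative sizes the currency is SUBADDITIVE in the residue: `ρ₁`-small plus `ρ₂`-small is `(ρ₁+ρ₂)`-small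
(`RelSmall.add`, `RelSmall.sub`), monotone in the size (`RelSmall.mono`), and a finite sum of pieces is small with the sum of the sizes
(`RelSmall.sum`).  The one real-variable inequality behind it is `sq_add_le_of_sq_le`: `b₁² ≤ r₁² s`, `b₂² ≤ r₂² s`, `s, r₁, r₂ ≥ 0 ⇒
(b₁ + b₂)² ≤ (r₁ + r₂)² s`.
-/

set_option linter.dupNamespace false

namespace Summit.AnomalousDissipation.AnomalousDissipation.Theorems.SolenoidalFractalHomogenisation.LagrangianStep.WCrossing

open Summit.AnomalousDissipation.AnomalousDissipation.Theorems
open Summit.AnomalousDissipation.AnomalousDissipation.Theorems.SolenoidalFractalHomogenisation.LagrangianStep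
open Literature.Analysis Literature.Analysis.FluidPDE Literature.Analysis.FunctionSpaces
open Set

noncomputable section

/-- The scalar inequality behind subadditivity: `b₁² ≤ r₁² s`, `b₂² ≤ r₂² s` with `s, r₁, r₂ ≥ 0` give `(b₁ + b₂)² ≤ (r₁ + r₂)² s`
(geometric-mean form of `|b₁| + |b₂| ≤ (r₁ + r₂)√s`). [folklore] -/
theorem sq_add_le_of_sq_le {b₁ b₂ r₁ r₂ s : ℝ} (hs : 0 ≤ s) (hr₁ : 0 ≤ r₁) (hr₂ : 0 ≤ r₂) (e₁ : b₁ ^ 2 ≤ r₁ ^ 2 * s)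
    (e₂ : b₂ ^ 2 ≤ r₂ ^ 2 * s) : (b₁ + b₂) ^ 2 ≤ (r₁ + r₂) ^ 2 * s := by
  have key : b₁ * b₂ ≤ r₁ * r₂ * s := by
    have hsq : (b₁ * b₂) ^ 2 ≤ (r₁ * r₂ * s) ^ 2 := by
      rw [mul_pow, show (r₁ * r₂ * s) ^ 2 = (r₁ ^ 2 * s) * (r₂ ^ 2 * s) by ring]
      exact mul_le_mul e₁ e₂ (sq_nonneg _) (by positivity)
    exact (abs_le_of_sq_le_sq' hsq (by positivity)).2
  nlinarith [e₁, e₂, key]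

/-- **Subadditivity of the residue currency**: a `ρ₁`-small and a `ρ₂`-small residue (relative to the same transversely nonnegative `A`) add up to a
`(ρ₁ + ρ₂)`-small one. [folklore] -/
theorem RelSmall.add {R₁ R₂ A : T4} {ρ₁ ρ₂ : ℝ} (h₁ : RelSmall R₁ A ρ₁) (h₂ : RelSmall R₂ A ρ₂) (hA : TransNonneg A) (hρ₁ : 0 ≤ ρ₁)
    (hρ₂ : 0 ≤ ρ₂) : RelSmall (R₁ + R₂) A (ρ₁ + ρ₂) := by
  intro k p q hp hq
  rw [Torus.bsymb_add]
  exact sq_add_le_of_sq_le (mul_nonneg (hA k p hp) (hA k q hq)) hρ₁ hρ₂ (h₁ k p q hp hq) (h₂ k p q hp hq)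

/-- The currency is even in the residue: `-R` is as small as `R`. [folklore] -/
theorem RelSmall.neg {R A : T4} {ρ : ℝ} (h : RelSmall R A ρ) : RelSmall (-R) A ρ := by
  intro k p q hp hq
  have e : Torus.bsymb (-R) k p q = -Torus.bsymb R k p q := by
    rw [← neg_one_smul ℝ R, Torus.bsymb_smul, neg_one_mul]
  rw [e, neg_sq]
  exact h k p q hp hq

/-- Subadditivity for differences: `R₁ - R₂` is `(ρ₁ + ρ₂)`-small. [folklore] -/
theorem RelSmall.sub {R₁ R₂ A : T4} {ρ₁ ρ₂ : ℝ} (h₁ : RelSmall R₁ A ρ₁) (h₂ : RelSmall R₂ A ρ₂) (hA : TransNonneg A) (hρ₁ : 0 ≤ ρ₁)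
    (hρ₂ : 0 ≤ ρ₂) : RelSmall (R₁ - R₂) A (ρ₁ + ρ₂) := by
  rw [sub_eq_add_neg]
  exact h₁.add h₂.neg hA hρ₁ hρ₂

/-- **Monotonicity in the size**: a `ρ`-small residue is `ρ'`-small for every `ρ' ≥ ρ ≥ 0`. [folklore] -/
theorem RelSmall.mono {R A : T4} {ρ ρ' : ℝ} (h : RelSmall R A ρ) (hA : TransNonneg A) (hρ : 0 ≤ ρ) (hle : ρ ≤ ρ') :
    RelSmall R A ρ' := by
  intro k p q hp hq
  have hs : 0 ≤ Torus.symb A k p * Torus.symb A k q := mul_nonneg (hA k p hp) (hA k q hq)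
  have hρρ : ρ ^ 2 ≤ ρ' ^ 2 := by gcongr
  exact (h k p q hp hq).trans (mul_le_mul_of_nonneg_right hρρ hs)

/-- The size of the zero residue can be taken to be `0`. [folklore] -/
theorem RelSmall.zero_zero (A : T4) : RelSmall 0 A 0 := by
  intro k p q _ _
  rw [Torus.bsymb_zero]
  simp

/-- **Finite sums of pieces**: if each piece `R i`, `i ∈ s`, is `ρ i`-small relative to `A` (transversely nonnegative, all `ρ i ≥ 0`), then
`∑ i ∈ s, R i` is `(∑ i ∈ s, ρ i)`-small. [folklore] -/
theorem RelSmall.sum {ι : Type*} (s : Finset ι) {R : ι → T4} {A : T4} {ρ : ι → ℝ} (hA : TransNonneg A) (hρ : ∀ i ∈ s, 0 ≤ ρ i)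
    (h : ∀ i ∈ s, RelSmall (R i) A (ρ i)) : RelSmall (∑ i ∈ s, R i) A (∑ i ∈ s, ρ i) := by
  classical
  induction s using Finset.induction_on with
  | empty => simpa using RelSmall.zero_zero A
  | insert a s ha ih =>
    rw [Finset.sum_insert ha, Finset.sum_insert ha]
    have hρs : 0 ≤ ∑ i ∈ s, ρ i := Finset.sum_nonneg fun i hi => hρ i (Finset.mem_insert_of_mem hi)
    exact (h a (Finset.mem_insert_self a s)).add (ih (fun i hi => hρ i (Finset.mem_insert_of_mem hi))
      (fun i hi => h i (Finset.mem_insert_of_mem hi))) hA (hρ a (Finset.mem_insert_self a s)) hρs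

/-- Relative smallness transfers along a radial comparison of the reference tensor: if `R` is `ρ`-small relative to `A` and `A ≼ B` transversally
on the diagonal (`symb A(k,p) ≤ symb B(k,p)` for `p ⊥ k`, with `A` transversely nonnegative), then `R` is `ρ`-small relative to `B`. [folklore] -/
theorem RelSmall.of_symb_le {R A B : T4} {ρ : ℝ} (h : RelSmall R A ρ) (hA : TransNonneg A)
    (hAB : ∀ k p : Fin 3 → ℝ, ∑ i, p i * k i = 0 → Torus.symb A k p ≤ Torus.symb B k p) : RelSmall R B ρ := by
  intro k p q hp hq
  refine (h k p q hp hq).trans (mul_le_mul_of_nonneg_left ?_ (sq_nonneg ρ))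
  exact mul_le_mul (hAB k p hp) (hAB k q hq) (hA k q hq) ((hA k p hp).trans (hAB k p hp))

end

end Summit.AnomalousDissipation.AnomalousDissipation.Theorems.SolenoidalFractalHomogenisation.LagrangianStep.WCrossing
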